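import Literature.Analysis.SpecialFunctions.DigammaLogBound
import Mathlib.MeasureTheory.Integral.DominatedConvergence
import Mathlib.Analysis.SpecialFunctions.ImproperIntegrals
import Mathlib.Analysis.SpecialFunctions.JapaneseBracket
import HarnessLib

/-!
# Dominated convergence for the archimedean term of the Weil functional

Stub `stub_archLimit` of the line "Sketch (heat cone)" for the crux
`Summit.RiemannHypothesis.RiemannHypothesis.Theses.RuelleBand.ExactFirstBand`: if a family
`F_R : ℝ → ℂ` (`R ≥ 1`) of continuous functions is uniformly dominated, `‖F_R(t)‖ ≤ D/(1+t²)`,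
and converges pointwise to `F_∞`, then
`∫ F_R(t) Re ψ(1/4 + it/2) dt → ∫ F_∞(t) Re ψ(1/4 + it/2) dt` as `R → ∞`.
The digamma factor is continuous (`ψ` is continuous on `Re w > 0`) and of logarithmic growth,
`|Re ψ(1/4 + it/2)| ≤ C + log(1 + |t|)`
(`Literature.Analysis.SpecialFunctions.Complex.exists_norm_digamma_vertical_le`), and
`log(1+|t|)/(1+t²) ≤ 4 (1+|t|)^{-3/2}` is integrable (`integrable_one_add_norm`), so Lebesgue's
dominated convergence theorem applies along the countably generated filter `atTop : Filter ℝ`.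
-/

set_option linter.dupNamespace false

noncomputable section

open Complex MeasureTheory Filter Set
open scoped Topology

namespace Summit.RiemannHypothesis.RiemannHypothesis.Theorems.RuelleBandExactFirstBand

/-- Elementary dominator estimate: for `C, D ≥ 0`,
`D/(1+t²) · (C + log(1+|t|)) ≤ 2D(C+2) (1+|t|)^{-3/2}`
(`log u ≤ 2√u` and `(1+|t|)² ≤ 2(1+t²)`). -/
theorem stub_archLimit_bound_le {C D : ℝ} (hC : 0 ≤ C) (hD : 0 ≤ D) (t : ℝ) :
    D / (1 + t ^ 2) * (C + Real.log (1 + |t|)) ≤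
      2 * D * (C + 2) * (1 + |t|) ^ (-(3 / 2 : ℝ)) := by
  set u : ℝ := 1 + |t| with hu
  have hu1 : 1 ≤ u := by simp [hu]
  have hu0 : 0 < u := by positivity
  have hlog : Real.log u ≤ 2 * u ^ (1 / 2 : ℝ) := by
    have := Real.log_le_rpow_div hu0.le (one_half_pos (α := ℝ))
    linarith
  have hs1 : 1 ≤ u ^ (1 / 2 : ℝ) := Real.one_le_rpow hu1 (by norm_num)
  have hCl : C + Real.log u ≤ (C + 2) * u ^ (1 / 2 : ℝ) := by nlinarith
  have hsq : u ^ 2 ≤ 2 * (1 + t ^ 2) := by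
    rw [hu]; nlinarith [sq_nonneg (|t| - 1), sq_abs t, abs_nonneg t]
  have hpos : 0 < 1 + t ^ 2 := by positivity
  have hD' : D / (1 + t ^ 2) ≤ 2 * D / u ^ 2 := by
    rw [div_le_div_iff₀ hpos (by positivity)]
    nlinarith
  have hr : u ^ (-(3 / 2 : ℝ)) = u ^ (1 / 2 : ℝ) / u ^ 2 := by
    rw [show (-(3 / 2 : ℝ)) = (1 / 2 : ℝ) - 2 by norm_num, Real.rpow_sub hu0, Real.rpow_two]
  have hl0 : 0 ≤ C + Real.log u := add_nonneg hC (Real.log_nonneg hu1)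
  calc D / (1 + t ^ 2) * (C + Real.log u)
      ≤ 2 * D / u ^ 2 * ((C + 2) * u ^ (1 / 2 : ℝ)) :=
        mul_le_mul hD' hCl hl0 (by positivity)
    _ = 2 * D * (C + 2) * u ^ (-(3 / 2 : ℝ)) := by
        rw [hr]; field_simp

/-- The digamma weight `t ↦ Re ψ(1/4 + it/2)` (as a complex number) is continuous: `ψ` is
continuous on the open right half-plane and `Re(1/4 + it/2) = 1/4 > 0`. -/
theorem stub_archLimit_continuous_weight :
    Continuous fun t : ℝ => ((Complex.digamma (1 / 4 + t / 2 * I)).re : ℂ) := by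
  have hψ : Continuous fun t : ℝ => Complex.digamma (1 / 4 + t / 2 * I) :=
    Literature.Analysis.SpecialFunctions.Complex.continuousOn_digamma.comp_continuous
      (by fun_prop) fun t => by
        simp only [mem_setOf_eq, add_re, mul_re, I_re, I_im, div_ofNat_re, ofReal_re,
          div_ofNat_im, ofReal_im]
        norm_num
  exact continuous_ofReal.comp (continuous_re.comp hψ)

/-- Logarithmic growth of the digamma weight: there is `C ≥ 0` with
`‖(Re ψ(1/4 + it/2) : ℂ)‖ ≤ C + log(1 + |t|)` for all real `t`
(`Literature.Analysis.SpecialFunctions.Complex.exists_norm_digamma_vertical_le` at `a = 1/4`,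
`y = t/2`, `|Re z| ≤ ‖z‖`, `log(1+|t|/2) ≤ log(1+|t|)`). -/
theorem stub_archLimit_norm_weight_le :
    ∃ C : ℝ, 0 ≤ C ∧ ∀ t : ℝ,
      ‖((Complex.digamma (1 / 4 + t / 2 * I)).re : ℂ)‖ ≤ C + Real.log (1 + |t|) := by
  obtain ⟨C, hC⟩ :=
    Literature.Analysis.SpecialFunctions.Complex.exists_norm_digamma_vertical_le
      (a := 1 / 4) (by norm_num)
  refine ⟨|C|, abs_nonneg C, fun t => ?_⟩
  have hw : (1 / 4 : ℂ) + (t : ℂ) / 2 * I = ((1 / 4 : ℝ) : ℂ) + ((t / 2 : ℝ) : ℂ) * I := by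
    push_cast; ring
  rw [Complex.norm_real, Real.norm_eq_abs, hw]
  have h1 := hC (t / 2)
  have h2 : Real.log (1 + |t / 2|) ≤ Real.log (1 + |t|) := by
    refine Real.log_le_log (by positivity) ?_
    rw [abs_div, abs_two]; linarith [abs_nonneg t]
  have h3 := Complex.abs_re_le_norm (Complex.digamma (((1 / 4 : ℝ) : ℂ) + ((t / 2 : ℝ) : ℂ) * I))
  linarith [le_abs_self C]

/-- **Dominated convergence for the archimedean term.** If `F_R` (`R ≥ 1`) are continuous,
uniformly dominated by `D/(1+t²)`, and converge pointwise to `F_∞` as `R → ∞`, then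
`∫ F_R(t) Re ψ(1/4 + it/2) dt → ∫ F_∞(t) Re ψ(1/4 + it/2) dt`: the products are dominated by
`D/(1+t²) · (C + log(1+|t|)) ≤ 2D(C+2)(1+|t|)^{-3/2}`, which is integrable on `ℝ`
(`integrable_one_add_norm`, `3/2 > 1 = dim ℝ`), and Lebesgue's theorem
(`MeasureTheory.tendsto_integral_filter_of_dominated_convergence`) applies along `atTop`. -/
theorem stub_archLimit :
    ∀ (F : ℝ → ℝ → ℂ) (Finf : ℝ → ℂ) (D : ℝ),
      (∀ R : ℝ, 1 ≤ R → Continuous (F R)) →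
      (∀ R : ℝ, 1 ≤ R → ∀ t : ℝ, ‖F R t‖ ≤ D / (1 + t ^ 2)) →
      (∀ t : ℝ, Tendsto (fun R : ℝ => F R t) atTop (𝓝 (Finf t))) →
      Tendsto (fun R : ℝ => ∫ t : ℝ, F R t * ((Complex.digamma (1 / 4 + t / 2 * I)).re : ℂ)) atTop
        (𝓝 (∫ t : ℝ, Finf t * ((Complex.digamma (1 / 4 + t / 2 * I)).re : ℂ))) := by
  intro F Finf D hcont hbd hlim
  obtain ⟨C, hC0, hC⟩ := stub_archLimit_norm_weight_le
  have hD0 : 0 ≤ D := by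
    have := hbd 1 le_rfl 0
    simp only [ne_eq, OfNat.ofNat_ne_zero, not_false_eq_true, zero_pow, add_zero, div_one] at this
    exact (norm_nonneg _).trans this
  have hint : Integrable fun t : ℝ => 2 * D * (C + 2) * (1 + ‖t‖) ^ (-(3 / 2 : ℝ)) := by
    refine (integrable_one_add_norm ?_).const_mul _
    simp only [Module.finrank_self, Nat.cast_one]
    norm_num
  refine tendsto_integral_filter_of_dominated_convergence
    (fun t : ℝ => 2 * D * (C + 2) * (1 + ‖t‖) ^ (-(3 / 2 : ℝ))) ?_ ?_ hint
    (Eventually.of_forall fun t => (hlim t).mul_const _)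
  · exact (eventually_ge_atTop (1 : ℝ)).mono fun R hR =>
      ((hcont R hR).mul stub_archLimit_continuous_weight).aestronglyMeasurable
  · refine (eventually_ge_atTop (1 : ℝ)).mono fun R hR => Eventually.of_forall fun t => ?_
    rw [norm_mul, Real.norm_eq_abs]
    have hl0 : 0 ≤ C + Real.log (1 + |t|) :=
      add_nonneg hC0 (Real.log_nonneg (by linarith [abs_nonneg t]))
    calc ‖F R t‖ * ‖((Complex.digamma (1 / 4 + t / 2 * I)).re : ℂ)‖
        ≤ D / (1 + t ^ 2) * (C + Real.log (1 + |t|)) :=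
          mul_le_mul (hbd R hR t) (hC t) (norm_nonneg _) (by positivity)
      _ ≤ 2 * D * (C + 2) * (1 + |t|) ^ (-(3 / 2 : ℝ)) := stub_archLimit_bound_le hC0 hD0 t

end Summit.RiemannHypothesis.RiemannHypothesis.Theorems.RuelleBandExactFirstBand

end
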